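import Mathlib
import HarnessLib
import Summits.ValiantsHypothesis.ValiantsHypothesis.Theses.MonotoneRestoration
import Literature.Computability.AlgebraicComplexity.ArithCircuit
import Literature.Computability.AlgebraicComplexity.ArithCircuitProofs
import Literature.Computability.AlgebraicComplexity.MonotoneStructure
import Literature.Computability.AlgebraicComplexity.PermanentIrreducible
import Literature.ModelTheory.FiniteModelTheory.CkEquiv
import Summits.ValiantsHypothesis.ValiantsHypothesis.Theorems.MonotoneRestorationMonotoneRestorationQPCosetCount
import Summits.ValiantsHypothesis.ValiantsHypothesis.Theorems.MonotoneRestorationMonotoneRestorationQPSymmetricLB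
import Summits.ValiantsHypothesis.ValiantsHypothesis.Theorems.MonotoneRestorationMonotoneRestorationQPSupportSymmetrisation
import Summits.ValiantsHypothesis.ValiantsHypothesis.Theorems.MonotoneRestorationMonotoneRestorationQPSparseRegime
import Summits.ValiantsHypothesis.ValiantsHypothesis.Theorems.MonotoneRestorationMonotoneRestorationQPBeta
import Literature.Computability.AlgebraicComplexity.SymmetricArithCircuit
import Literature.Computability.AlgebraicComplexity.DawarWilsenach2025Proofs
import Literature.GroupTheory.PermutationGroups.SmallIndexSubgroups
import Summits.ValiantsHypothesis.ValiantsHypothesis.Theorems.MonotoneRestorationQP.Negative.LoadBearing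
import Summits.ValiantsHypothesis.ValiantsHypothesis.Theorems.MonotoneRestorationMonotoneRestorationQPPermSupportCount
import Literature.Computability.AlgebraicComplexity.ElementarySymmetricCircuit

/-! TTRL-lite variant V20263 of stmt-ValiantsHypothesis-15886 -/

set_option linter.dupNamespace false

namespace Summit.ValiantsHypothesis.ValiantsHypothesis.Theorems

open Summit.ValiantsHypothesis.ValiantsHypothesis.Theses.MonotoneRestoration
open Literature.Computability.AlgebraicComplexity

set_option linter.unusedVariables false in
/-- TTRL-lite variant V20263 (move `generalise`) of `stmt-ValiantsHypothesis-15886`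
(`stub_esymmRowSums_complexity`): over EVERY commutative semiring `K`, for a RECTANGULAR `n × m`
matrix of variables `x_{i,j}` with row sums `R_i = Σ_j x_{i,j}` and EVERY degree `d`, the
fan-in-two circuit complexity of `e_d(R_0, …, R_{n-1})` is at most `2 (d+1) n + n m`
(dynamic programme for `e_d` in `2 (d+1) n` gates after substituting the `n` row sums, each of
cost `m`). Immediate from the tree's
`Literature.Computability.AlgebraicComplexity.complexity_esymm_rowSums_le` with `ι = Fin n`,
`κ = Fin m`. The instance binder carries the name `inst` of the machine-generated variant statement
(kept verbatim), whence the scoped `unusedVariables` exemption.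
[cite: Burgisser2000, Def. 2.1, Rem. 2.7] -/
theorem stub_esymmRowSums_complexity_var20263 :
    ∀ (K : Type) [inst : CommSemiring K] (n m d : ℕ),
      complexity (MvPolynomial.bind₁ (fun i : Fin n => ∑ j : Fin m, MvPolynomial.X (i, j))
        (MvPolynomial.esymm (Fin n) K d)) ≤ 2 * (d + 1) * n + n * m := by
  intro K _ n m d
  simpa only [Fintype.card_fin] using
    (complexity_esymm_rowSums_le (R := K) (ι := Fin n) (κ := Fin m) d)

end Summit.ValiantsHypothesis.ValiantsHypothesis.Theorems
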